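import Summits.Ventures.QEC.Census.CertCoverBatch
import Summits.Ventures.QEC.Census.TwoBGA.TB_l6m24_A0_0_0_1_3_11_B0_0_1_11_5_4.Q144.L1Iface
import HarnessLib

set_option Elab.async false
set_option maxRecDepth 200000

/-!
# `quotient-[[144,12,d_Z≥8]]` one-level cover certificate of `TB_l6m24_A0_0_0_1_3_11_B0_0_1_11_5_4.Q144` — WITNESS TABLE round trip, part A: `orbCheckAux ePermqs eTr eInv 36` on representative chunks 0–0
(≤ 80 representatives × 36 translations each; type-12 lockstep `permWordL`; qec-type-10 `CertCoverBatch.orbCheck`). Data (chunk lists) + decided checks; KERNEL. qec-search-1 g5.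
-/

namespace Summit.Ventures.QEC.Census.TB_l6m24_A0_0_0_1_3_11_B0_0_1_11_5_4.Q144

open Matrix Summit.Ventures.QEC.Census Literature.InformationTheory.QuantumCodes

/-- Representatives 0–0. -/
def repsC0 : List ℕ :=
  [
    0x400300400000a0]

set_option maxHeartbeats 400000000 in
/-- Round trip on chunk 0 (1 representatives × 36 translations). -/
theorem orbChk0 : orbCheckAux TB_l6m24_A0_0_0_1_3_11_B0_0_1_11_5_4.Q144.ePermqs eTr eInv 36 repsC0 = true := by decide +kernel


end Summit.Ventures.QEC.Census.TB_l6m24_A0_0_0_1_3_11_B0_0_1_11_5_4.Q144
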